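import Summits.ValiantsHypothesis.ValiantsHypothesis.Theorems.NewtonUnitEquationsTwoProductsRankOneThreeLawPlanar
import HarnessLib

/-!
# Route NewtonUnitEquations — crux `TwoProducts` (stmt-ValiantsHypothesis-5906), line `relation_ladder`, rung R6b (three-term
# rank one, shape `α = β + γ`): the FREE LIFT — `RankOneThreeLaw`, UNCONDITIONAL — part 5/6 — per visible point a zero-avoiding strict pencil-minimiser; the fibrewise count via `ShiftRank.pencilCount` (Part T8, first half)

(T8) per visible point a zero-avoiding strict pencil-minimiser of a slice function (`RelData.sliceMin_of_visible`); the uniform width surrogate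
`Nm`, the slice bound `sliceBd`; the per-slice count `sliceCount` from finite shift rank (val-lit-p3's `ShiftRank.pencilCount` +
`BinExpSum.pencilCount_arith`, BY NAME); the count `RelData.count` for a non-degenerate relation.

val-idea-8 g3 (ideator; lens decomp), 2026-08-28. Companion of the R6 module (shape `α + β = γ + δ`, Segre lift). New ingredient: the
relation is INHOMOGENEOUS, so the fibres of the lift `Y_α ↦ Y_β Y_γ` have VARYING letter count and the slice sums are no longer
binomial-exponential sums of bounded width; they carry the extra factor `C(λ(ν) + b - 1 - k, b - k)` with `λ` an ADDITIVE form, which still has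
finite SHIFT RANK — so val-lit-p3's general strict-pencil-minimiser count for finite shift rank (`…FormalLogLinearisation.ShiftRank.pencilCount`,
LANDED p620579) applies BY NAME.

PORT NOTE (val-lit-p3 g15, prover seat, helper mode `--supports stmt-ValiantsHypothesis-5906 --as helper`, no stub credit claimed;
desk RULING #279 (c)): part 5/6 of a VERBATIM Theorems-side port of val-idea-8 g3's sorry-free module
`Cruxes/TwoProducts/Lines/relation_ladder_R6b.lean` (tree @988ccfe3a7f4; file sha256 da7520fdfde8796f…; 1 661 lines; `lean check` rc 0,
0 sorries) into files of ≤ 400 lines, following the R6 port (`…RankOneFourLaw{Toric,Fibres,Slice,Planar,Weights,Count}`, p11 g1 / p3 g14).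
ALL mathematics and ALL proofs below are val-idea-8 g3's (engine memo `Cruxes/TwoProducts/Lines/relation_ladder_R6_engine.md` rev 3 §7′,
card `Lines/relation_ladder.md` v14). The port changes only: (i) the file split and the import chain; (ii) the generic toolkit that the source
re-declares VERBATIM from the R6 module (`phiT/piT` family, `piT_apply`, `ofFun`, `multinomial_univ`, `tab`, `sgn`, `binChar` + lemmas,
`toolBound_mono`, the toric Lemma A `toric_minLog` with `coeff_zero_phiT_lin/coeff_zero_one_add_phiT_lin/phiT_liftG/phiT_logTrunc`,
`RankOneCoincidences`, `rankOneCoincidences_of_permType`, `msetT_apply_eq_zero`, `idxOf`, `enum_idxOf`, `rW`, `lwt_single`, `lwt_piT`) is NOT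
re-declared but IMPORTED from the landed R6 port (`…RankOneFourLaw*`, namespace `…PermutationType`, identical texts), so every such name below
resolves to the landed declaration; (iii) `set_option linter.deprecated false` dropped; (iv) one-line docstrings on API lemmas required by the
tree's docstring lint; (v) in part 6/6 the parameter-free `def RankOneThreeLaw : Prop` is NOT declared (the gate relocates such defs, cf. the R6
port delta p622844) — the law is stated by its LITERAL body as `rankOneThreeLaw_proof`. Namespace = the author's (`…PermutationType.R6b`).
Nothing here closes the line's residual, the crux `TwoProducts` (5906) or `VP ≠ VNP`; no summit statement is proved.

Honest scope (the author's): the shape `2β = α + γ` (R6c) and coincidence rank `≥ 2` (R7) are NOT covered here and go to the residual of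
skeleton v15. Nothing here moves VP ≠ VNP; `TwoProducts` (5906) stays OPEN. [folklore]
-/

noncomputable section

-- Sub = Summit single-conjunct layout: the duplicated namespace component is mandated by the tree.
set_option linter.dupNamespace false
set_option linter.unusedSimpArgs false
set_option linter.unusedSectionVars false

namespace Summit.ValiantsHypothesis.ValiantsHypothesis.Theorems.NewtonUnitEquations.TwoProducts.PermutationType
namespace R6b
open scoped BigOperators
open MvPolynomial

variable {σ : Type*} [Fintype σ] [DecidableEq σ]

variable (I : ThreeIdx σ)

/-! ## Part T8: per visible point a zero-avoiding strict pencil-minimiser of a slice function; the fibrewise count via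
val-lit-p3's `ShiftRank.pencilCount`; the arithmetic; the law -/

section FreeCount
open Summit.ValiantsHypothesis.ValiantsHypothesis.Theorems.NewtonUnitEquations.TwoProducts.FormalLogLinearisation
open Summit.ValiantsHypothesis.ValiantsHypothesis.Theorems.NewtonUnitEquations.TwoProducts.PlanarCell

variable {m : ℕ} {u v : Fin m → MvPolynomial (Fin 2) ℂ} (D : RelData u v)

omit [Fintype σ] [DecidableEq σ] in
/-- **Per visible point.** A visible point `l` (valid `ξ`) yields a toric point `x₀` over it (`x₀(a) = 0`) with slice coordinate
`b = x₀(c) ≤ m`, whose reduced exponent `x̂₀` is a zero-avoiding STRICT minimiser of the letter-weight functional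
`ν ↦ Σ_i r_i ν_i` on `{ν : F_b(ν) ≠ 0}` over ALL of `ℕ^s`. [folklore] -/
theorem RelData.sliceMin_of_visible (hu : ∀ j, coeff 0 (u j) = 0) (hv : ∀ j, coeff 0 (v j) = 0)
    (hinj : Set.InjOn (piE (enum u v)) ↑D.GT.support) (ξ : Fin 2 → ℝ) (hval : ValidWeight u v ξ) (l : Expo)
    (htop : IsStrictTop ξ ↑(tailDiff u v).support l) :
    ∃ x₀ : Fin (sE u v) →₀ ℕ, piE (enum u v) x₀ = l ∧ x₀ D.idx.a = 0 ∧ x₀ D.idx.c ≤ m ∧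
      Fsl D.idx (cU u v) (cV u v) (x₀ D.idx.c) (xhat D.idx x₀) ≠ 0 ∧
      ∀ ν : Fin (sE u v) → ℕ, ν ≠ ⇑(xhat D.idx x₀) → Fsl D.idx (cU u v) (cV u v) (x₀ D.idx.c) ν ≠ 0 →
        ∑ i, rW ξ i * ((xhat D.idx x₀ i : ℕ) : ℝ) < ∑ i, rW (u := u) (v := v) ξ i * (ν i : ℝ) := by
  classical
  have _hu := hu; have _hv := hv
  obtain ⟨x₀, hx₀, hπ, hmin⟩ := D.lifted_of_visible hinj ξ l htop
  obtain ⟨L₀, hL₀, hx₀L⟩ := D.exists_of_mem_support_GT x₀ hx₀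
  have hx₀a : x₀ D.idx.a = 0 := D.apply_a_of_mem_support_GT x₀ hx₀
  have hdegL : deg L₀ ≤ m := deg_le_of_mem_support_liftG _ _ L₀ hL₀
  have hc_le : x₀ D.idx.c ≤ m := by
    rw [← hx₀L, piT_frM_c]
    have h := deg_eq_sum L₀
    rw [sum_three_split D.idx] at h
    omega
  -- the upstairs weights and their normalisation
  set θ : Fin (sE u v) → ℝ := rW ξ with hθdef
  have hθpos : ∀ i, 0 < θ i := rW_pos ξ hval
  have hne : (Finset.univ : Finset (Fin (sE u v))).Nonempty := ⟨D.idx.a, Finset.mem_univ _⟩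
  set θmin : ℝ := Finset.univ.inf' hne θ with hθmin
  have hθmin_pos : 0 < θmin := by
    obtain ⟨i, -, hi⟩ := Finset.exists_mem_eq_inf' hne θ
    rw [hθmin, hi]; exact hθpos i
  have hθmin_le : ∀ i, θmin ≤ θ i := fun i => Finset.inf'_le θ (Finset.mem_univ i)
  set θ' : Fin (sE u v) → ℝ := fun i => θ i / θmin with hθ'
  have hθ'1 : ∀ i, 1 ≤ θ' i := fun i => by
    rw [hθ']; simp only; rw [le_div_iff₀ hθmin_pos, one_mul]; exact hθmin_le i
  have hlwt' : ∀ x : Fin (sE u v) →₀ ℕ, lwt θ' x = lwt θ x / θmin := fun x => by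
    unfold lwt; rw [Finset.sum_div]
    refine Finset.sum_congr rfl fun i _ => ?_
    rw [hθ']; ring
  have hlwtG : ∀ x ∈ D.GT.support, lwt θ x = -wt ξ (piE (enum u v) x) := fun x hx => by
    obtain ⟨L, -, rfl⟩ := D.exists_of_mem_support_GT x hx
    exact D.lwt_rW_piT ξ L
  have hminθ' : x₀ ∈ (phiT (frM D.idx) (liftG (cU u v) (cV u v))).support ∧
      ∀ x ∈ (phiT (frM D.idx) (liftG (cU u v) (cV u v))).support, x ≠ x₀ → lwt θ' x₀ < lwt θ' x := by
    refine ⟨hx₀, fun x hx hne' => ?_⟩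
    rw [hlwt', hlwt']
    apply div_lt_div_of_pos_right _ hθmin_pos
    rw [hlwtG x₀ hx₀, hlwtG x hx, hπ]
    linarith [hmin x hx hne']
  have hA := toric_minLog (frM D.idx) (frM_ne_zero D.idx) θ' hθ'1 (cU u v) (cV u v) x₀ hminθ'
  set R : ℕ := ⌊lwt θ' x₀⌋₊ + 1 with hRdef
  have hRlt : lwt θ' x₀ < R := by rw [hRdef]; push_cast; exact Nat.lt_floor_add_one _
  -- `x₀ ≠ 0` and `deg x₀ ≤ R`
  have hx₀ne : x₀ ≠ 0 := by
    intro h0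
    have := mem_support_iff.mp hx₀
    apply this
    rw [h0]
    unfold RelData.GT
    rw [phiT_liftG, coeff_sub,
      coeff_zero_prod_eq_one _ (fun j => coeff_zero_one_add_phiT_lin (frM D.idx) (frM_ne_zero D.idx) _),
      coeff_zero_prod_eq_one _ (fun j => coeff_zero_one_add_phiT_lin (frM D.idx) (frM_ne_zero D.idx) _), sub_self]
  have hdegR : deg x₀ ≤ R := by
    have h2 : (deg x₀ : ℝ) ≤ lwt θ' x₀ := deg_le_lwt θ' hθ'1 x₀
    have h3 : (deg x₀ : ℝ) < R := lt_of_le_of_lt h2 hRlt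
    have h4 : deg x₀ < R := by exact_mod_cast h3
    omega
  have hF0 : Fsl D.idx (cU u v) (cV u v) (x₀ D.idx.c) (xhat D.idx x₀) ≠ 0 :=
    (mem_support_free_logTrunc_iff D.idx (cU u v) (cV u v) R x₀ hx₀a hx₀ne hdegR).mp hA.1
  refine ⟨x₀, hπ, hx₀a, hc_le, hF0, fun ν hν hFν => ?_⟩
  obtain ⟨hνa, hνc⟩ := shape_of_Fsl_ne_zero D.idx (cU u v) (cV u v) _ ν hFν
  set x' : Fin (sE u v) →₀ ℕ := xOf D.idx (x₀ D.idx.c) ν with hx'def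
  have hx'a : x' D.idx.a = 0 := xOf_a D.idx _ ν
  have hxh' : ⇑(xhat D.idx x') = ν := xhat_xOf D.idx _ ν hνa hνc
  have hx'c : x' D.idx.c = x₀ D.idx.c := xOf_c D.idx _ ν
  have hne' : x' ≠ x₀ := by
    intro h; apply hν; rw [← hxh', h]
  have hx'ne : x' ≠ 0 := by
    intro hz
    have hνz : ∀ j, ν j = 0 := fun j => by rw [← hxh', hz]; simp [xhat]
    have hb0 : x₀ D.idx.c = 0 := by rw [← hx'c, hz]; rfl
    apply hFν
    rw [hb0]; exact Fsl_zero_zero D.idx (cU u v) (cV u v) ν hνz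
  have hlt' : lwt θ' x₀ < lwt θ' x' := by
    by_cases hR' : deg x' ≤ R
    · have hmem : x' ∈ (phiT (frM D.idx) (logTrunc (cU u v) (cV u v) R)).support :=
        (mem_support_free_logTrunc_iff D.idx (cU u v) (cV u v) R x' hx'a hx'ne hR').mpr
          (by rw [hx'c, hxh']; exact hFν)
      exact hA.2 x' hmem hne'
    · push Not at hR'
      have h2 : (deg x' : ℝ) ≤ lwt θ' x' := deg_le_lwt θ' hθ'1 x'
      have h3 : (R : ℝ) < deg x' := by exact_mod_cast hR'
      linarith
  have hlt : lwt θ x₀ < lwt θ x' := by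
    have := hlt'
    rw [hlwt', hlwt'] at this
    exact (div_lt_div_iff_of_pos_right hθmin_pos).mp this
  rw [lwt_split D.idx θ x₀ hx₀a, lwt_split D.idx θ x' hx'a, hx'c] at hlt
  rw [hxh'] at hlt
  linarith

/-- The uniform width surrogate `N_m = 2 m (m+1)^3 + 1 ≥ |SIdx m b|` (`b ≤ m`). [folklore] -/
def Nm (m : ℕ) : ℕ := 2 * m * (m + 1) ^ 3 + 1

/-- The slice bound, uniform in `b ≤ m`. [folklore] -/
def sliceBd (m s : ℕ) : ℕ := (s + 2) ^ 3 * (Nm m + 2) ^ (3 * (Nat.log 2 (Nm m + 2) + 1))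


omit [Fintype σ] [DecidableEq σ] in
/-- **The per-slice count** from finite shift rank (val-lit-p3's `ShiftRank.pencilCount`, BY NAME). [folklore] -/
theorem sliceCount (b : ℕ) (hbm : b ≤ m) (U V : Fin (sE u v) → ℝ) (Sb : Finset (Fin (sE u v) → ℕ))
    (hhyp : ∀ μ ∈ Sb, Fsl D.idx (cU u v) (cV u v) b μ ≠ 0 ∧ ∃ t : ℝ, ∀ ν : Fin (sE u v) → ℕ, ν ≠ μ →
      Fsl D.idx (cU u v) (cV u v) b ν ≠ 0 → ∑ i, (U i + t * V i) * (μ i : ℝ) < ∑ i, (U i + t * V i) * (ν i : ℝ)) :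
    Sb.card ≤ sliceBd m (sE u v) := by
  obtain ⟨col, ch, hF⟩ := Fsl_shift D.idx (cU u v) (cV u v) b
  have h1 := ShiftRank.pencilCount hF U V Sb hhyp
  rw [card_SIdx] at h1
  have h2 := BinExpSum.pencilCount_arith (sE u v) (2 * m * (b + 1) ^ 3 + 1)
  have h3 : 2 * m * (b + 1) ^ 3 + 1 ≤ Nm m :=
    Nat.add_le_add_right (Nat.mul_le_mul_left _ (Nat.pow_le_pow_left (by omega) 3)) 1
  exact h1.trans (h2.trans (toolBound_mono (sE u v) 3 h3))

omit [Fintype σ] [DecidableEq σ] in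
/-- **The count for a non-degenerate three-term rank-one relation** (all three letters in the alphabet). [folklore] -/
theorem RelData.count (hu : ∀ j, coeff 0 (u j) = 0) (hv : ∀ j, coeff 0 (v j) = 0)
    (hR : RankOneCoincidences (fun j => (u j).support ∪ (v j).support)
      (Finsupp.single D.β 1 + Finsupp.single D.γ 1) (Finsupp.single D.α 1))
    (S : Finset Expo) (hS : ∀ l ∈ S, ∃ ξ : Fin 2 → ℝ, ValidWeight u v ξ ∧ IsStrictTop ξ ↑(tailDiff u v).support l) :
    S.card ≤ (m + 1) * sliceBd m (sE u v) := by
  classical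
  rcases S.eq_empty_or_nonempty with hSe | hSne
  · simp [hSe]
  obtain ⟨l₀, hl₀⟩ := hSne
  obtain ⟨ξ₀, hval₀, htop₀⟩ := hS l₀ hl₀
  have hTne : (tailSupport u v).Nonempty := tailSupport_nonempty_of_mem u v l₀ htop₀.1
  have hsE : 0 < sE u v := Finset.card_pos.mpr hTne
  set e₀ : Expo := enum u v ⟨0, hsE⟩ with he₀def
  have he₀ : e₀ ≠ 0 := enum_ne_zero u v hu hv _
  obtain ⟨β, τ, hpencil⟩ := pencil_param e₀ he₀
  have hinj := D.injOn_of_rankOne hu hv hR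
  -- choices along `S`
  have hξ : ∀ x : ↥S, ∃ ξ : Fin 2 → ℝ, ValidWeight u v ξ ∧ IsStrictTop ξ ↑(tailDiff u v).support x.1 :=
    fun x => hS x.1 x.2
  choose ξf hξval hξtop using hξ
  have hpt : ∀ x : ↥S, ∃ x₀ : Fin (sE u v) →₀ ℕ, piE (enum u v) x₀ = x.1 ∧ x₀ D.idx.a = 0 ∧ x₀ D.idx.c ≤ m ∧
      Fsl D.idx (cU u v) (cV u v) (x₀ D.idx.c) (xhat D.idx x₀) ≠ 0 ∧
      ∀ ν : Fin (sE u v) → ℕ, ν ≠ ⇑(xhat D.idx x₀) → Fsl D.idx (cU u v) (cV u v) (x₀ D.idx.c) ν ≠ 0 →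
        ∑ i, rW (ξf x) i * ((xhat D.idx x₀ i : ℕ) : ℝ) < ∑ i, rW (u := u) (v := v) (ξf x) i * (ν i : ℝ) :=
    fun x => D.sliceMin_of_visible hu hv hinj (ξf x) (hξval x) x.1 (hξtop x)
  choose xf hxπ hxa hxc hxF hxmin using hpt
  -- normalisation radii and the pencil parameter
  have hrpos : ∀ x : ↥S, 0 < -wt (ξf x) e₀ := fun x => by
    linarith [wt_enum_neg u v (ξf x) (hξval x) ⟨0, hsE⟩]
  have hnorm : ∀ x : ↥S, wt (fun k => ξf x k / (-wt (ξf x) e₀)) e₀ = -1 := fun x => by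
    rw [wt_weight_div]
    have hne : wt (ξf x) e₀ ≠ 0 := by linarith [hrpos x]
    rw [div_neg, div_self hne]
  have hc : ∀ x : ↥S, ∃ c : ℝ, ∀ e : Expo, wt (fun k => ξf x k / (-wt (ξf x) e₀)) e = wt β e + c * wt τ e :=
    fun x => hpencil _ (hnorm x)
  choose cf hcf using hc
  set U : Fin (sE u v) → ℝ := fun i => -wt β (enum u v i) with hU
  set V : Fin (sE u v) → ℝ := fun i => -wt τ (enum u v i) with hV
  have hUV : ∀ (x : ↥S) (i : Fin (sE u v)),
      U i + cf x * V i = rW (ξf x) i / (-wt (ξf x) e₀) := fun x i => by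
    have h := hcf x (enum u v i)
    rw [wt_weight_div] at h
    rw [hU, hV]
    unfold rW
    simp only
    rw [neg_div, h]
    ring
  have hsumUV : ∀ (x : ↥S) (ν : Fin (sE u v) → ℕ), ∑ i, (U i + cf x * V i) * (ν i : ℝ) =
      (∑ i, rW (ξf x) i * (ν i : ℝ)) / (-wt (ξf x) e₀) := fun x ν => by
    rw [Finset.sum_div]
    refine Finset.sum_congr rfl fun i _ => ?_
    rw [hUV x i]
    ring
  -- the key map `l ↦ (b, x̂₀)` is injective
  set key : ↥S → ℕ × (Fin (sE u v) → ℕ) := fun x => (xf x D.idx.c, ⇑(xhat D.idx (xf x))) with hkey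
  have hinjK : Function.Injective key := by
    intro x y h
    rw [hkey] at h
    simp only [Prod.mk.injEq] at h
    have hx : xf x = xf y := by
      rw [← xOf_xhat D.idx (xf x) (hxa x), ← xOf_xhat D.idx (xf y) (hxa y), h.1]
      exact congrArg _ h.2
    apply Subtype.ext
    rw [← hxπ x, ← hxπ y, hx]
  set Img : Finset (ℕ × (Fin (sE u v) → ℕ)) := (Finset.univ : Finset ↥S).image key with hImg
  have hcard : Img.card = S.card := by
    rw [hImg, Finset.card_image_of_injective _ hinjK, Finset.card_univ, Fintype.card_coe]
  have hfst : ∀ p ∈ Img, p.1 ∈ Finset.range (m + 1) := by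
    intro p hp
    obtain ⟨x, -, rfl⟩ := Finset.mem_image.mp hp
    exact Finset.mem_range.mpr (Nat.lt_succ_of_le (hxc x))
  have hfib : ∀ b ∈ Finset.range (m + 1), (Img.filter fun p => p.1 = b).card ≤ sliceBd m (sE u v) := by
    intro b hb
    have hbm : b ≤ m := Nat.lt_succ_iff.mp (Finset.mem_range.mp hb)
    set Sb : Finset (Fin (sE u v) → ℕ) := (Img.filter fun p => p.1 = b).image Prod.snd with hSb
    have hcardb : (Img.filter fun p => p.1 = b).card = Sb.card := by
      rw [hSb, Finset.card_image_of_injOn]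
      intro p hp q hq hpq
      have hp' := (Finset.mem_filter.mp (Finset.mem_coe.mp hp)).2
      have hq' := (Finset.mem_filter.mp (Finset.mem_coe.mp hq)).2
      exact Prod.ext (hp'.trans hq'.symm) hpq
    rw [hcardb]
    refine sliceCount D b hbm U V Sb fun μ hμ => ?_
    obtain ⟨p, hp, rfl⟩ := Finset.mem_image.mp hμ
    obtain ⟨hpI, hpb⟩ := Finset.mem_filter.mp hp
    obtain ⟨x, -, rfl⟩ := Finset.mem_image.mp hpI
    rw [hkey] at hpb ⊢
    simp only at hpb ⊢
    refine ⟨?_, cf x, fun ν hν hFν => ?_⟩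
    · have := hxF x
      rw [hpb] at this
      exact this
    · have hFν' : Fsl D.idx (cU u v) (cV u v) (xf x D.idx.c) ν ≠ 0 := by rw [hpb]; exact hFν
      have hlt := hxmin x ν hν hFν'
      rw [hsumUV x, hsumUV x ν]
      exact div_lt_div_of_pos_right hlt (hrpos x)
  rw [← hcard, Finset.card_eq_sum_card_fiberwise hfst]
  calc ∑ b ∈ Finset.range (m + 1), (Img.filter fun p => p.1 = b).card
      ≤ ∑ b ∈ Finset.range (m + 1), sliceBd m (sE u v) := Finset.sum_le_sum hfib
    _ = (m + 1) * sliceBd m (sE u v) := by rw [Finset.sum_const, Finset.card_range, smul_eq_mul]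

end FreeCount

end R6b
end Summit.ValiantsHypothesis.ValiantsHypothesis.Theorems.NewtonUnitEquations.TwoProducts.PermutationType

end
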